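import Mathlib
import HarnessLib
import Summits.AtomisticToContinuum.FouriersLaw.Theses.JunctionLocality
import Summits.AtomisticToContinuum.FouriersLaw.Theorems.JunctionLocalitySuperadditiveResistanceDeviceLiouville
import Summits.AtomisticToContinuum.FouriersLaw.Theorems.JunctionLocalitySuperadditiveResistanceThermoIBP

/-!
# Kubo–Onsager for the γ-thermostatted pinned chain, I: the energy-cutoff toolkit

Helper file (`--supports` stmt-AtomisticToContinuum-11748) for the line `floating-probe-bypass-laplacian` of
the crux `JunctionLocality.SuperadditiveResistance`, stub `stub_kuboOnsager` (the equilibrium Kubo matrix of the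
device's forward fields is an Onsager Laplacian). The forward fields `g = (−L)⁻¹ k` of the stub are `C²` and
square integrable for the Gibbs state `μ_T`, but NOT compactly supported and with no pointwise growth control, so
every integration by parts against `μ_T` goes through the energy cutoffs `χ_n = φ(H/(n+1))` of the first lead's
`DeviceCutoff` file. This file fixes ONE profile `φ` (`kuboProfile`, by choice from `exists_profile`) and proves,
for the pinned chain `pinnedChain ω₂ lam β γ` (`ω₂ > 0`, `lam, β ≥ 0`) at temperature `T > 0`:

* `chi` — the cutoff family; smooth, compactly supported, `0 ≤ χ_n ≤ 1`, `= 1` on `{H ≤ n+1}`, `|∂_{p_i} χ_n| ≤ 2K`,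
  `∂_{p_i} χ_n = 0` on `{H < n+1}`;
* `tendsto_integral_chi_mul` — `∫ χ_n F ρ → ∫ F ρ` and `tendsto_integral_partialP_chi_mul` — `∫ (∂_{p_i}χ_n) F ρ → 0`
  for every `F` with `F ρ ∈ L¹` (dominated convergence);
* `integral_chi_liouville_antisymm` — EXACT antisymmetry of `X_H` at every cutoff level:
  `∫ χ_n (f X_H g + g X_H f) ρ = 0` for `f, g ∈ C²` (the cutoff is a first integral, `X_H χ_n = 0`);
* `integral_chi_mul_bathOp` — the Ornstein–Uhlenbeck Dirichlet form at cutoff level: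
  `∫ χ_n f (S_B g) ρ = −T Σ_i B_i (∫ χ_n ∂_i f ∂_i g ρ + ∫ f ∂_iχ_n ∂_i g ρ)` for `f, g ∈ C²`.

Here `ρ = e^{−H/T}`, `X_H = liouvilleOp`, `S_B = bathOp L B T`. References: Eckmann–Pillet–Rey-Bellet 1999 §3; folklore.
-/

noncomputable section

open MeasureTheory Filter Topology ProbabilityTheory
open scoped ContDiff NNReal
open Literature.MathematicalPhysics.KineticTheory.HeatConduction
open Summit.AtomisticToContinuum.FouriersLaw.Theorems.SuperadditiveResistance.DeviceLiouville
open Summit.AtomisticToContinuum.FouriersLaw.Cruxes.SuperadditiveResistance.ThermaliseThenCutProbeInsertion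
  (integral_ou_mul_gibbsDensity')

namespace Summit.AtomisticToContinuum.FouriersLaw.Theorems.SuperadditiveResistance.Kubo

/-! ## A fixed cutoff profile -/

/-- A fixed smooth profile `φ : ℝ → [0,1]` (`= 1` on `[-1,1]`, `= 0` off `(-2,2)`, `(φ')² ≤ K φ`), chosen once
and for all from `exists_profile`. [folklore] -/
def kuboProfile : ℝ → ℝ := Classical.choose exists_profile

/-- The constant `K` of the fixed profile. [folklore] -/
def kuboConst : ℝ := Classical.choose (Classical.choose_spec exists_profile)

/-- The defining properties of the fixed profile. [folklore] -/
theorem kuboProfile_spec :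
    ContDiff ℝ ∞ kuboProfile ∧ (∀ s, |s| ≤ 1 → kuboProfile s = 1) ∧
    (∀ s, 2 ≤ |s| → kuboProfile s = 0) ∧ (∀ s, 0 ≤ kuboProfile s) ∧ (∀ s, kuboProfile s ≤ 1) ∧
    0 ≤ kuboConst ∧ (∀ s, deriv kuboProfile s ^ 2 ≤ kuboConst * kuboProfile s) ∧
    (∀ s, |deriv kuboProfile s| ≤ kuboConst) ∧ (∀ s, |deriv (deriv kuboProfile) s| ≤ kuboConst) ∧
    (∀ s, |s| < 1 → deriv kuboProfile s = 0 ∧ deriv (deriv kuboProfile) s = 0) ∧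
    (∀ s, 2 < |s| → deriv kuboProfile s = 0 ∧ deriv (deriv kuboProfile) s = 0) :=
  Classical.choose_spec (Classical.choose_spec exists_profile)

variable (P : OscillatorChain)

/-- The energy cutoff family `χ_n = φ(H/(n+1))`. [folklore] -/
def chi (L : ℕ) (n : ℕ) : PhaseSpace L → ℝ := cutoff P kuboProfile L ((n : ℝ) + 1)

variable {P}

section General

variable {L : ℕ}

/-- `0 < n + 1`. [folklore] -/
theorem radius_pos (n : ℕ) : (0 : ℝ) < (n : ℝ) + 1 := by positivity

/-- `1 ≤ n + 1`. [folklore] -/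
theorem one_le_radius (n : ℕ) : (1 : ℝ) ≤ (n : ℝ) + 1 := by
  have : (0 : ℝ) ≤ n := n.cast_nonneg
  linarith

/-- `χ_n` is smooth when `H` is. [folklore] -/
theorem contDiff_chi (hH : ContDiff ℝ ∞ (P.hamiltonian L)) (n : ℕ) : ContDiff ℝ ∞ (chi P L n) :=
  contDiff_cutoff kuboProfile_spec.1 hH _

/-- `0 ≤ χ_n`. [folklore] -/
theorem chi_nonneg (n : ℕ) (x : PhaseSpace L) : 0 ≤ chi P L n x :=
  cutoff_nonneg P kuboProfile_spec.2.2.2.1 _ x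

/-- `χ_n ≤ 1`. [folklore] -/
theorem chi_le_one (n : ℕ) (x : PhaseSpace L) : chi P L n x ≤ 1 :=
  cutoff_le_one P kuboProfile_spec.2.2.2.2.1 _ x

/-- `|χ_n| ≤ 1`. [folklore] -/
theorem abs_chi_le_one (n : ℕ) (x : PhaseSpace L) : |chi P L n x| ≤ 1 := by
  rw [abs_of_nonneg (chi_nonneg n x)]
  exact chi_le_one n x

/-- `χ_n = 1` on `{H ≤ n+1}` (for `H ≥ 0`). [folklore] -/
theorem chi_eq_one {n : ℕ} {x : PhaseSpace L} (hH0 : 0 ≤ P.hamiltonian L x)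
    (hx : P.hamiltonian L x ≤ (n : ℝ) + 1) : chi P L n x = 1 :=
  cutoff_eq_one P kuboProfile_spec.2.1 (radius_pos n) hH0 hx

/-- `χ_n x = 1` eventually in `n`, at every point with `H x ≥ 0`. [folklore] -/
theorem eventually_chi_eq_one {x : PhaseSpace L} (hH0 : 0 ≤ P.hamiltonian L x) :
    ∀ᶠ n : ℕ in atTop, chi P L n x = 1 := by
  obtain ⟨N, hN⟩ := exists_nat_ge (P.hamiltonian L x)
  filter_upwards [Filter.eventually_ge_atTop N] with n hn
  refine chi_eq_one hH0 (hN.trans ?_)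
  have : (N : ℝ) ≤ n := by exact_mod_cast hn
  linarith

/-- `∂_{p_i} χ_n = 0` on `{H < n+1}` (for `H ≥ 0`, `H` differentiable). [folklore] -/
theorem partialP_chi_eq_zero (hH : Differentiable ℝ (P.hamiltonian L)) {n : ℕ} {x : PhaseSpace L}
    (hH0 : 0 ≤ P.hamiltonian L x) (hx : P.hamiltonian L x < (n : ℝ) + 1) (i : Fin L) :
    partialP i (chi P L n) x = 0 := by
  have hφd : Differentiable ℝ kuboProfile := kuboProfile_spec.1.differentiable (by simp)
  unfold chi
  rw [partialP_cutoff hφd hH]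
  have : |P.hamiltonian L x / ((n : ℝ) + 1)| < 1 := by
    rw [abs_of_nonneg (div_nonneg hH0 (radius_pos n).le), div_lt_one (radius_pos n)]
    exact hx
  rw [(kuboProfile_spec.2.2.2.2.2.2.2.2.2.1 _ this).1, zero_mul]

/-- `∂_{p_i} χ_n x = 0` eventually in `n`. [folklore] -/
theorem eventually_partialP_chi_eq_zero (hH : Differentiable ℝ (P.hamiltonian L)) {x : PhaseSpace L}
    (hH0 : 0 ≤ P.hamiltonian L x) (i : Fin L) :
    ∀ᶠ n : ℕ in atTop, partialP i (chi P L n) x = 0 := by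
  obtain ⟨N, hN⟩ := exists_nat_gt (P.hamiltonian L x)
  filter_upwards [Filter.eventually_ge_atTop N] with n hn
  refine partialP_chi_eq_zero hH hH0 (hN.trans_le ?_) i
  have : (N : ℝ) ≤ n := by exact_mod_cast hn
  linarith

end General

section Pinned

variable {ω₂ lam β : ℝ} {L : ℕ}

/-- `χ_n` has compact support (sublevel sets of `H` are compact for the pinned chain). [folklore] -/
theorem hasCompactSupport_chi (hω : 0 < ω₂) (hl : 0 ≤ lam) (hβ : 0 ≤ β) (γ : ℝ) (L n : ℕ) :
    HasCompactSupport (chi (pinnedChain ω₂ lam β γ) L n) :=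
  HasCompactSupport.intro
    (pinnedChain_isCompact_setOf_hamiltonian_le hω hl hβ γ L (2 * ((n : ℝ) + 1)))
    (fun x hx => cutoff_eq_zero _ kuboProfile_spec.2.2.1 (radius_pos n)
      (pinnedChain_hamiltonian_nonneg hω.le hl hβ γ L x) (le_of_lt (not_le.mp hx)))

/-- Uniform bound `|∂_{p_i} χ_n| ≤ 2K` for the pinned chain (`|φ'| ≤ K`, and on the transition layer
`p_i² ≤ 2H ≤ 4r`, `r ≥ 1`). [folklore] -/
theorem abs_partialP_chi_le (hω : 0 ≤ ω₂) (hl : 0 ≤ lam) (hβ : 0 ≤ β) (γ : ℝ) (L n : ℕ) (i : Fin L)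
    (x : PhaseSpace L) : |partialP i (chi (pinnedChain ω₂ lam β γ) L n) x| ≤ 2 * kuboConst := by
  obtain ⟨hφs, -, -, -, -, hK, -, hdK, -, -, hd2⟩ := kuboProfile_spec
  have hφd : Differentiable ℝ kuboProfile := hφs.differentiable (by simp)
  have hHd : Differentiable ℝ ((pinnedChain ω₂ lam β γ).hamiltonian L) :=
    ((pinnedChain ω₂ lam β γ).contDiff_hamiltonian (pinnedChain_contDiff_U ω₂ lam β γ (n := 1))
      (pinnedChain_contDiff_V ω₂ lam β γ (n := 1)) L).differentiable one_ne_zero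
  have hH0 : 0 ≤ (pinnedChain ω₂ lam β γ).hamiltonian L x := pinnedChain_hamiltonian_nonneg hω hl hβ γ L x
  have hp2 := pinnedChain_sq_le_two_mul_hamiltonian hω hl hβ γ L x i
  set r : ℝ := (n : ℝ) + 1 with hr
  have hr1 : 1 ≤ r := one_le_radius n
  have hr0 : 0 < r := radius_pos n
  unfold chi
  rw [partialP_cutoff hφd hHd]
  generalize hE : (pinnedChain ω₂ lam β γ).hamiltonian L x = E at hH0 hp2
  by_cases hcase : 2 < |E / r|
  · rw [(hd2 _ hcase).1, zero_mul, abs_zero]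
    positivity
  · have hEle : E ≤ 2 * r := by
      rw [not_lt, abs_of_nonneg (div_nonneg hH0 hr0.le), div_le_iff₀ hr0] at hcase
      exact hcase
    have hp : x.2 i ^ 2 ≤ 4 * r := hp2.trans (by linarith)
    have hpr : |x.2 i| / r ≤ 2 := by
      rw [div_le_iff₀ hr0]
      have h1 : |x.2 i| ^ 2 ≤ (2 * r) ^ 2 := by
        rw [sq_abs]; nlinarith
      have h2 : |x.2 i| ≤ 2 * r := abs_le_of_sq_le_sq' h1 (by positivity) |>.2
      linarith
    rw [abs_mul, abs_div, abs_of_pos hr0]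
    calc |deriv kuboProfile (E / r)| * (|x.2 i| / r) ≤ kuboConst * 2 :=
          mul_le_mul (hdK _) hpr (by positivity) hK
      _ = 2 * kuboConst := by ring

/-- **Removing the cutoff.** If `F ρ ∈ L¹` then `∫ χ_n F ρ → ∫ F ρ`. [folklore] -/
theorem tendsto_integral_chi_mul (hω : 0 ≤ ω₂) (hl : 0 ≤ lam) (hβ : 0 ≤ β) (γ : ℝ) (L : ℕ) (T : ℝ)
    {F : PhaseSpace L → ℝ} (hFm : AEStronglyMeasurable F volume)
    (hF : Integrable fun x => F x * (pinnedChain ω₂ lam β γ).gibbsDensity L T x) :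
    Tendsto (fun n : ℕ => ∫ x, chi (pinnedChain ω₂ lam β γ) L n x * F x *
      (pinnedChain ω₂ lam β γ).gibbsDensity L T x) atTop
      (𝓝 (∫ x, F x * (pinnedChain ω₂ lam β γ).gibbsDensity L T x)) := by
  have hHc : Continuous ((pinnedChain ω₂ lam β γ).hamiltonian L) :=
    pinnedChain_continuous_hamiltonian ω₂ lam β γ L
  have hχc : ∀ n, Continuous (chi (pinnedChain ω₂ lam β γ) L n) := fun n =>
    kuboProfile_spec.1.continuous.comp (hHc.div_const _)
  refine tendsto_integral_of_dominated_convergence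
    (fun x => ‖F x * (pinnedChain ω₂ lam β γ).gibbsDensity L T x‖)
    (fun n => ((hχc n).aestronglyMeasurable.mul hFm).mul
      (pinnedChain_continuous_gibbsDensity ω₂ lam β γ L T).aestronglyMeasurable) hF.norm
    (fun n => ae_of_all _ fun x => ?_) (ae_of_all _ fun x => ?_)
  · rw [mul_assoc, norm_mul]
    calc ‖chi (pinnedChain ω₂ lam β γ) L n x‖ * ‖F x * (pinnedChain ω₂ lam β γ).gibbsDensity L T x‖
        ≤ 1 * ‖F x * (pinnedChain ω₂ lam β γ).gibbsDensity L T x‖ :=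
          mul_le_mul_of_nonneg_right (by rw [Real.norm_eq_abs]; exact abs_chi_le_one n x)
            (norm_nonneg _)
      _ = _ := one_mul _
  · refine tendsto_const_nhds.congr' ?_
    filter_upwards [eventually_chi_eq_one (P := pinnedChain ω₂ lam β γ)
      (pinnedChain_hamiltonian_nonneg hω hl hβ γ L x)] with n hn
    rw [hn, one_mul]

/-- **The cutoff's gradient terms vanish in the limit.** If `F ρ ∈ L¹` then `∫ (∂_{p_i}χ_n) F ρ → 0`
(`|∂_{p_i}χ_n| ≤ 2K`, and `∂_{p_i}χ_n → 0` pointwise, indeed eventually `0`). [folklore] -/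
theorem tendsto_integral_partialP_chi_mul (hω : 0 < ω₂) (hl : 0 ≤ lam) (hβ : 0 ≤ β) (γ : ℝ) (L : ℕ)
    (T : ℝ) (i : Fin L) {F : PhaseSpace L → ℝ} (hFm : AEStronglyMeasurable F volume)
    (hF : Integrable fun x => F x * (pinnedChain ω₂ lam β γ).gibbsDensity L T x) :
    Tendsto (fun n : ℕ => ∫ x, partialP i (chi (pinnedChain ω₂ lam β γ) L n) x * F x *
      (pinnedChain ω₂ lam β γ).gibbsDensity L T x) atTop (𝓝 0) := by
  have hHs : ContDiff ℝ ∞ ((pinnedChain ω₂ lam β γ).hamiltonian L) :=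
    (pinnedChain ω₂ lam β γ).contDiff_hamiltonian (pinnedChain_contDiff_U ω₂ lam β γ)
      (pinnedChain_contDiff_V ω₂ lam β γ) L
  have hHd : Differentiable ℝ ((pinnedChain ω₂ lam β γ).hamiltonian L) := hHs.differentiable (by simp)
  have hdχc : ∀ n, Continuous (partialP i (chi (pinnedChain ω₂ lam β γ) L n)) := fun n =>
    continuous_partialP (contDiff_chi hHs n) (by simp) i
  have h := tendsto_integral_of_dominated_convergence
    (fun x => 2 * kuboConst * ‖F x * (pinnedChain ω₂ lam β γ).gibbsDensity L T x‖)
    (F := fun (n : ℕ) x => partialP i (chi (pinnedChain ω₂ lam β γ) L n) x * F x *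
      (pinnedChain ω₂ lam β γ).gibbsDensity L T x) (f := fun _ => 0) (μ := volume)
    (fun n => ((hdχc n).aestronglyMeasurable.mul hFm).mul
      (pinnedChain_continuous_gibbsDensity ω₂ lam β γ L T).aestronglyMeasurable) (hF.norm.const_mul _)
    (fun n => ae_of_all _ fun x => ?_) (ae_of_all _ fun x => ?_)
  · simpa using h
  · rw [mul_assoc, norm_mul]
    exact mul_le_mul_of_nonneg_right
      (by rw [Real.norm_eq_abs]; exact abs_partialP_chi_le hω.le hl hβ γ L n i x) (norm_nonneg _)
  · refine tendsto_const_nhds.congr' ?_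
    filter_upwards [eventually_partialP_chi_eq_zero hHd
      (pinnedChain_hamiltonian_nonneg hω.le hl hβ γ L x) i] with n hn
    rw [hn, zero_mul, zero_mul]

/-! ## Exact identities at a fixed cutoff level -/

/-- `X_H` is a derivation: `X_H(fg) = f X_H g + g X_H f`. [folklore] -/
theorem liouvilleOp_mul (P : OscillatorChain) {f g : PhaseSpace L → ℝ} (hf : Differentiable ℝ f)
    (hg : Differentiable ℝ g) (x : PhaseSpace L) :
    liouvilleOp P L (fun y => f y * g y) x = f x * liouvilleOp P L g x + g x * liouvilleOp P L f x := by
  unfold liouvilleOp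
  rw [Finset.mul_sum, Finset.mul_sum, ← Finset.sum_add_distrib]
  refine Finset.sum_congr rfl fun i _ => ?_
  rw [partialQ_mul hf hg, partialP_mul hf hg]
  ring

/-- **Exact antisymmetry of the Liouville operator at every cutoff level.** For `f, g ∈ C²` and the pinned chain
(`T ≠ 0`): `∫ χ_n (f X_H g + g X_H f) e^{-H/T} = 0` — apply the weak `μ_T`-invariance of `X_H`
(`integral_genOp_mul_gibbsDensity` with `σ = 1`, `c = 0`) to `χ_n f g ∈ C²_c` and use `X_H χ_n = 0`. [folklore] -/
theorem integral_chi_liouville_antisymm (hω : 0 < ω₂) (hl : 0 ≤ lam) (hβ : 0 ≤ β) (γ : ℝ) (L : ℕ)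
    {T : ℝ} (hT : T ≠ 0) {f g : PhaseSpace L → ℝ} (hf : ContDiff ℝ 2 f) (hg : ContDiff ℝ 2 g) (n : ℕ) :
    ∫ x, chi (pinnedChain ω₂ lam β γ) L n x *
      (f x * liouvilleOp (pinnedChain ω₂ lam β γ) L g x + g x * liouvilleOp (pinnedChain ω₂ lam β γ) L f x) *
        (pinnedChain ω₂ lam β γ).gibbsDensity L T x = 0 := by
  have hU := pinnedChain_contDiff_U ω₂ lam β γ (n := ∞)
  have hV := pinnedChain_contDiff_V ω₂ lam β γ (n := ∞)
  have hHs : ContDiff ℝ ∞ ((pinnedChain ω₂ lam β γ).hamiltonian L) :=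
    (pinnedChain ω₂ lam β γ).contDiff_hamiltonian hU hV L
  have hHd : Differentiable ℝ ((pinnedChain ω₂ lam β γ).hamiltonian L) := hHs.differentiable (by simp)
  have hχs : ContDiff ℝ ∞ (chi (pinnedChain ω₂ lam β γ) L n) := contDiff_chi hHs n
  have hχ2 : ContDiff ℝ 2 (chi (pinnedChain ω₂ lam β γ) L n) := hχs.of_le (by norm_cast)
  have hχd : Differentiable ℝ (chi (pinnedChain ω₂ lam β γ) L n) := hχ2.differentiable two_ne_zero
  have hfd : Differentiable ℝ f := hf.differentiable two_ne_zero
  have hgd : Differentiable ℝ g := hg.differentiable two_ne_zero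
  have hfgd : Differentiable ℝ (fun y => f y * g y) := hfd.mul hgd
  have hF2 : ContDiff ℝ 2 (fun y => chi (pinnedChain ω₂ lam β γ) L n y * (f y * g y)) := hχ2.mul (hf.mul hg)
  have hFc : HasCompactSupport (fun y => chi (pinnedChain ω₂ lam β γ) L n y * (f y * g y)) :=
    (hasCompactSupport_chi hω hl hβ γ L n).mul_right
  have hzero := integral_genOp_mul_gibbsDensity (pinnedChain ω₂ lam β γ) (hU.of_le (by norm_cast))
    (hV.of_le (by norm_cast)) L (fun _ => (0 : ℝ)) hT 1 0 hF2 hFc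
  have hlio : ∀ x, liouvilleOp (pinnedChain ω₂ lam β γ) L (chi (pinnedChain ω₂ lam β γ) L n) x = 0 :=
    fun x => liouvilleOp_cutoff (kuboProfile_spec.1.differentiable (by simp)) hHd _ x
  have hpt : ∀ x, 1 * liouvilleOp (pinnedChain ω₂ lam β γ) L
      (fun y => chi (pinnedChain ω₂ lam β γ) L n y * (f y * g y)) x +
      0 * bathOp L (fun _ => (0 : ℝ)) T (fun y => chi (pinnedChain ω₂ lam β γ) L n y * (f y * g y)) x =
      chi (pinnedChain ω₂ lam β γ) L n x * (f x * liouvilleOp (pinnedChain ω₂ lam β γ) L g x +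
        g x * liouvilleOp (pinnedChain ω₂ lam β γ) L f x) := by
    intro x
    rw [one_mul, zero_mul, add_zero, liouvilleOp_mul _ hχd hfgd, liouvilleOp_mul _ hfd hgd, hlio]
    ring
  rw [← hzero]
  refine integral_congr_ae (ae_of_all _ fun x => ?_)
  dsimp only
  rw [hpt x]

/-- **The Ornstein–Uhlenbeck Dirichlet form at cutoff level.** For `f, g ∈ C²`, site weights `B` and the pinned
chain: `∫ χ_n f (S_B g) ρ = −T Σ_i B_i (∫ χ_n ∂_{p_i}f ∂_{p_i}g ρ + ∫ f ∂_{p_i}χ_n ∂_{p_i}g ρ)`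
(one-site Gaussian integration by parts `integral_ou_mul_gibbsDensity'` with the compactly supported test function
`χ_n f`). [folklore] -/
theorem integral_chi_mul_bathOp (hω : 0 < ω₂) (hl : 0 ≤ lam) (hβ : 0 ≤ β) (γ : ℝ) (L : ℕ)
    (B : Fin L → ℝ) {T : ℝ} (hT : T ≠ 0) {f g : PhaseSpace L → ℝ} (hf : ContDiff ℝ 2 f)
    (hg : ContDiff ℝ 2 g) (n : ℕ) :
    ∫ x, chi (pinnedChain ω₂ lam β γ) L n x * f x * bathOp L B T g x *
        (pinnedChain ω₂ lam β γ).gibbsDensity L T x =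
      -T * ∑ i, B i * ((∫ x, chi (pinnedChain ω₂ lam β γ) L n x * partialP i f x * partialP i g x *
          (pinnedChain ω₂ lam β γ).gibbsDensity L T x) +
        ∫ x, f x * partialP i (chi (pinnedChain ω₂ lam β γ) L n) x * partialP i g x *
          (pinnedChain ω₂ lam β γ).gibbsDensity L T x) := by
  have hU := pinnedChain_contDiff_U ω₂ lam β γ (n := ∞)
  have hV := pinnedChain_contDiff_V ω₂ lam β γ (n := ∞)
  have hHs : ContDiff ℝ ∞ ((pinnedChain ω₂ lam β γ).hamiltonian L) :=
    (pinnedChain ω₂ lam β γ).contDiff_hamiltonian hU hV L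
  have hχs : ContDiff ℝ ∞ (chi (pinnedChain ω₂ lam β γ) L n) := contDiff_chi hHs n
  have hχ1 : ContDiff ℝ 1 (chi (pinnedChain ω₂ lam β γ) L n) := hχs.of_le (by norm_cast)
  have hχd : Differentiable ℝ (chi (pinnedChain ω₂ lam β γ) L n) := hχ1.differentiable one_ne_zero
  have hχc : HasCompactSupport (chi (pinnedChain ω₂ lam β γ) L n) := hasCompactSupport_chi hω hl hβ γ L n
  have hf1 : ContDiff ℝ 1 f := hf.of_le (by norm_cast)
  have hfd : Differentiable ℝ f := hf.differentiable two_ne_zero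
  have hρc : Continuous ((pinnedChain ω₂ lam β γ).gibbsDensity L T) :=
    pinnedChain_continuous_gibbsDensity ω₂ lam β γ L T
  -- the compactly supported test function h = χ_n f
  have hh1 : ContDiff ℝ 1 (fun y => chi (pinnedChain ω₂ lam β γ) L n y * f y) := hχ1.mul hf1
  have hhc : HasCompactSupport (fun y => chi (pinnedChain ω₂ lam β γ) L n y * f y) := hχc.mul_right
  have hg1 : ∀ i, ContDiff ℝ 1 (partialP i g) := fun i => contDiff_partialP hg (by norm_num) i
  have hgC1 : ∀ i, Continuous (partialP i g) := fun i => (hg1 i).continuous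
  have hgC2 : ∀ i, Continuous (partialP i (partialP i g)) := fun i =>
    continuous_partialP (hg1 i) one_ne_zero i
  -- one-site identity with the test function χ_n f
  have hsite : ∀ i : Fin L, ∫ x, (T * partialP i (partialP i g) x - x.2 i * partialP i g x) *
      (chi (pinnedChain ω₂ lam β γ) L n x * f x) * (pinnedChain ω₂ lam β γ).gibbsDensity L T x =
      -T * ((∫ x, chi (pinnedChain ω₂ lam β γ) L n x * partialP i f x * partialP i g x *
          (pinnedChain ω₂ lam β γ).gibbsDensity L T x) +
        ∫ x, f x * partialP i (chi (pinnedChain ω₂ lam β γ) L n) x * partialP i g x *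
          (pinnedChain ω₂ lam β γ).gibbsDensity L T x) := by
    intro i
    have e := integral_ou_mul_gibbsDensity' (pinnedChain ω₂ lam β γ) (hU.of_le (by norm_cast))
      (hV.of_le (by norm_cast)) T T hg hh1 hhc i
    rw [div_self hT, sub_self, zero_mul, add_zero] at e
    rw [e]
    have hprod : ∀ x, partialP i (fun y => chi (pinnedChain ω₂ lam β γ) L n y * f y) x =
        partialP i (chi (pinnedChain ω₂ lam β γ) L n) x * f x +
          chi (pinnedChain ω₂ lam β γ) L n x * partialP i f x := fun x => partialP_mul hχd hfd i x
    have hI1 : Integrable fun x => chi (pinnedChain ω₂ lam β γ) L n x * partialP i f x * partialP i g x *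
        (pinnedChain ω₂ lam β γ).gibbsDensity L T x := by
      refine Continuous.integrable_of_hasCompactSupport ?_ ((hχc.mul_right).mul_right.mul_right)
      have := continuous_partialP hf1 one_ne_zero i
      have := hχ1.continuous
      fun_prop
    have hI2 : Integrable fun x => f x * partialP i (chi (pinnedChain ω₂ lam β γ) L n) x * partialP i g x *
        (pinnedChain ω₂ lam β γ).gibbsDensity L T x := by
      refine Continuous.integrable_of_hasCompactSupport ?_
        (((hasCompactSupport_partialP hχd hχc i).mul_left).mul_right.mul_right)
      have := continuous_partialP hχ1 one_ne_zero i
      have := hf.continuous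
      fun_prop
    have hsplit : (fun x => partialP i g x * partialP i (fun y => chi (pinnedChain ω₂ lam β γ) L n y * f y) x *
        (pinnedChain ω₂ lam β γ).gibbsDensity L T x) = fun x =>
        f x * partialP i (chi (pinnedChain ω₂ lam β γ) L n) x * partialP i g x *
            (pinnedChain ω₂ lam β γ).gibbsDensity L T x +
          chi (pinnedChain ω₂ lam β γ) L n x * partialP i f x * partialP i g x *
            (pinnedChain ω₂ lam β γ).gibbsDensity L T x := by
      funext x; rw [hprod x]; ring
    rw [hsplit, integral_add hI2 hI1]
    ring
  -- integrability of each site term of S_B g against the test function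
  have hint : ∀ i : Fin L, Integrable fun x => B i * ((T * partialP i (partialP i g) x - x.2 i * partialP i g x) *
      (chi (pinnedChain ω₂ lam β γ) L n x * f x) * (pinnedChain ω₂ lam β γ).gibbsDensity L T x) := by
    intro i
    refine (Continuous.integrable_of_hasCompactSupport ?_ ((hhc.mul_left).mul_right)).const_mul (B i)
    have := hgC1 i
    have := hgC2 i
    have := hh1.continuous
    fun_prop
  have hsplit : (fun x => chi (pinnedChain ω₂ lam β γ) L n x * f x * bathOp L B T g x *
      (pinnedChain ω₂ lam β γ).gibbsDensity L T x) = fun x => ∑ i, B i *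
        ((T * partialP i (partialP i g) x - x.2 i * partialP i g x) *
          (chi (pinnedChain ω₂ lam β γ) L n x * f x) * (pinnedChain ω₂ lam β γ).gibbsDensity L T x) := by
    funext x
    simp only [bathOp, Finset.sum_mul, Finset.mul_sum]
    refine Finset.sum_congr rfl fun i _ => ?_
    ring
  rw [hsplit, integral_finsetSum _ fun i _ => hint i, Finset.mul_sum]
  refine Finset.sum_congr rfl fun i _ => ?_
  rw [integral_const_mul, hsite i]
  ring

end Pinned

/-- Registered helper sub-goal `helper_kuboCutoffBath` of stub `stub_kuboOnsager` (= `integral_chi_mul_bathOp` in stub form; line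
`floating-probe-bypass-laplacian`, crux stmt-AtomisticToContinuum-11748). [folklore] -/
theorem helper_kuboCutoffBath : ∀ {ω₂ lam β : ℝ}, 0 < ω₂ → 0 ≤ lam → 0 ≤ β → ∀ (γ : ℝ) (L : ℕ) (B : Fin L → ℝ) {T : ℝ}, T ≠ 0 → ∀ {f g : PhaseSpace L → ℝ}, ContDiff ℝ 2 f → ContDiff ℝ 2 g → ∀ (n : ℕ), ∫ x, chi (pinnedChain ω₂ lam β γ) L n x * f x * bathOp L B T g x * (pinnedChain ω₂ lam β γ).gibbsDensity L T x = -T * ∑ i, B i * ((∫ x, chi (pinnedChain ω₂ lam β γ) L n x * partialP i f x * partialP i g x * (pinnedChain ω₂ lam β γ).gibbsDensity L T x) + ∫ x, f x * partialP i (chi (pinnedChain ω₂ lam β γ) L n) x * partialP i g x * (pinnedChain ω₂ lam β γ).gibbsDensity L T x) :=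
  @integral_chi_mul_bathOp

end Summit.AtomisticToContinuum.FouriersLaw.Theorems.SuperadditiveResistance.Kubo

end
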